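import Summits.Langlands.Langlands.Theses.FernRankSplit
import Summits.Langlands.Langlands.Theorems.FernRankSplitFernSpread

/-!
# Route FernRankSplit — SizeDepthExchange (stmt-Langlands-27017), by name from the landed twin

The support item EXCH = `Summit.Langlands.Langlands.Theses.FernRankSplit.SizeDepthExchange` of the child route `FernRankSplit`
(born 2026-09-01T00:04Z, thaw slot 9) is, token for token, the proposition proved on 2026-08-31 in the census twin of the lens-3 g30 node
as `Summit.Langlands.Langlands.Theorems.FernRank.sizeDepthExchange_holds` (module `Theorems/FernRankSplitFernSpread.lean`, p833705; the exchange lemma itself is in `Theorems/FernRankSplitExchange.lean`, p833648):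
a k-member family weakly r-approximating ρ off S contains a member strongly close to ρ (apply at radius min(r,1)^k). This file closes the
route item BY NAME with that landed theorem (alias-grade re-attachment; nothing new is proved; nothing here proves `Langlands`).
-/

set_option linter.dupNamespace false -- project-wide option (lakefile weak.linter.dupNamespace); `Summit.Langlands.Langlands` is the mandated namespace

namespace Summit.Langlands.Langlands.Theorems

/-- **SizeDepthExchange of route FernRankSplit** (stmt-Langlands-27017), proved by the landed theorem
`FernRank.sizeDepthExchange_holds` (the two `Prop`s have the same body; `unfold` + `exact`). -/
theorem fernRankSplit_sizeDepthExchange_proof :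
    Summit.Langlands.Langlands.Theses.FernRankSplit.SizeDepthExchange := by
  unfold Summit.Langlands.Langlands.Theses.FernRankSplit.SizeDepthExchange
  exact Summit.Langlands.Langlands.Theorems.FernRank.sizeDepthExchange_holds

end Summit.Langlands.Langlands.Theorems
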